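import Mathlib
import HarnessLib

/-!
# The implicit function theorem in block form on a product of Banach spaces

Topic `Literature/Analysis/Calculus` (namespace `Literature.Analysis.Calculus`). For
`f : X × Y → Z` (`X, Y, Z` Banach over `𝕜 = ℝ` or `ℂ`), `Cⁿ` (`n ≥ 1`) at `p = (x₀, y₀)` with
derivative in block form `Df(p)(u, v) = f_x u + f_y v`, `f_x : X ≃L Z` INVERTIBLE, there is a
`Cⁿ` germ `g : Y → X` at `y₀` with `g(y₀) = x₀`, `f(g(y), y) = f(p)` near `y₀`, every solution of
`f(q) = f(p)` near `p` lies on the graph of `g`, and `Dg(y₀) = −f_x⁻¹ ∘ f_y`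
(`exists_implicit_of_block_deriv`). Proof: the inverse function theorem
(`ContDiffAt.localInverse`) for `Ψ(x, y) = (f(x, y), y)`. This is the form used for systems of
finitely many real equations (e.g. the two real equations `Re A = Im A = 0` in the unknowns
`(ω_R, μ)` with parameter `ε = Im ω` of Shlapentokh-Rothman, CMP 329 (2014), §4.3); the case
`X = Y = Z = 𝕜` is `ScalarImplicitFunction.lean`. Everything is proved.

## References

* S. Lang, *Real and Functional Analysis*, Ch. XIV §2 (implicit mapping theorem from the inverse
  mapping theorem). [folklore]
* Y. Shlapentokh-Rothman, Comm. Math. Phys. 329 (2014) 859–891, §4.3. Key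
  `ShlapentokhRothman2014KleinGordon`.
-/

noncomputable section

open Set Filter Topology

namespace Literature.Analysis.Calculus

variable {𝕜 : Type*} [RCLike 𝕜]
  {X : Type*} [NormedAddCommGroup X] [NormedSpace 𝕜 X] [CompleteSpace X]
  {Y : Type*} [NormedAddCommGroup Y] [NormedSpace 𝕜 Y] [CompleteSpace Y]
  {Z : Type*} [NormedAddCommGroup Z] [NormedSpace 𝕜 Z]

/-- **Implicit function theorem, block form.** Let `f : X × Y → Z` be `Cⁿ` at `p` (`1 ≤ n`) with
`HasFDerivAt f (f_x ∘ fst + f_y ∘ snd) p` where `f_x : X ≃L[𝕜] Z` is invertible. Then there is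
`g : Y → X`, `Cⁿ` at `p.2`, with `g p.2 = p.1`, `f (g y, y) = f p` for `y` near `p.2`, local
uniqueness (`f q = f p` near `p` forces `q.1 = g q.2`), and `HasFDerivAt g (−f_x⁻¹ ∘ f_y) p.2`.
[folklore] -/
theorem exists_implicit_of_block_deriv {f : X × Y → Z} {p : X × Y} {n : WithTop ℕ∞}
    (hf : ContDiffAt 𝕜 n f p) (hn : 1 ≤ n) (fx : X ≃L[𝕜] Z) (fy : Y →L[𝕜] Z)
    (hd : HasFDerivAt f ((fx : X →L[𝕜] Z).comp (ContinuousLinearMap.fst 𝕜 X Y) + fy.comp (ContinuousLinearMap.snd 𝕜 X Y)) p) :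
    ∃ g : Y → X, g p.2 = p.1 ∧ ContDiffAt 𝕜 n g p.2 ∧ (∀ᶠ y in 𝓝 p.2, f (g y, y) = f p) ∧
      (∀ᶠ q in 𝓝 p, f q = f p → q.1 = g q.2) ∧
      HasFDerivAt g (-((fx.symm : Z →L[𝕜] X).comp fy)) p.2 := by
  have hn0 : n ≠ 0 := by positivity
  -- `Ψ = (f, snd)` and its block-triangular derivative with inverse `M`
  set Ψ : X × Y → Z × Y := fun q ↦ (f q, q.2) with hΨ
  set L : X × Y →L[𝕜] Z := (fx : X →L[𝕜] Z).comp (ContinuousLinearMap.fst 𝕜 X Y) + fy.comp (ContinuousLinearMap.snd 𝕜 X Y)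
    with hL
  set Ψ' : X × Y →L[𝕜] Z × Y := L.prod (ContinuousLinearMap.snd 𝕜 X Y) with hΨ'
  set M : Z × Y →L[𝕜] X × Y :=
    (((fx.symm : Z →L[𝕜] X).comp (ContinuousLinearMap.fst 𝕜 Z Y)) -
        ((fx.symm : Z →L[𝕜] X).comp (fy.comp (ContinuousLinearMap.snd 𝕜 Z Y)))).prod (ContinuousLinearMap.snd 𝕜 Z Y)
    with hM
  have hΨ'_apply : ∀ q : X × Y, Ψ' q = (fx q.1 + fy q.2, q.2) := fun q ↦ by simp [hΨ', hL]
  have hM_apply : ∀ q : Z × Y, M q = (fx.symm q.1 - fx.symm (fy q.2), q.2) := fun q ↦ by simp [hM]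
  have hleft : Function.LeftInverse M Ψ' := fun q ↦ by
    rw [hΨ'_apply, hM_apply]
    ext
    · simp
    · rfl
  have hright : Function.RightInverse M Ψ' := fun q ↦ by
    rw [hM_apply, hΨ'_apply]
    ext
    · simp
    · rfl
  set Φ : (X × Y) ≃L[𝕜] (Z × Y) := ContinuousLinearEquiv.equivOfInverse Ψ' M hleft hright with hΦ
  have hΨc : ContDiffAt 𝕜 n Ψ p := hf.prodMk contDiffAt_snd
  have hΨd : HasFDerivAt Ψ (Φ : X × Y →L[𝕜] Z × Y) p := by
    have h : HasFDerivAt Ψ Ψ' p := hd.prodMk (hasFDerivAt_snd (𝕜 := 𝕜) (E := X) (F := Y))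
    exact h
  have hs : HasStrictFDerivAt Ψ (Φ : X × Y →L[𝕜] Z × Y) p := hΨc.hasStrictFDerivAt' hΨd hn0
  set inv := hs.localInverse Ψ Φ p with hinv
  have hΨp : Ψ p = (f p, p.2) := rfl
  set g : Y → X := fun y ↦ (inv (f p, y)).1 with hg
  have hemb_at : Tendsto (fun y : Y ↦ (f p, y)) (𝓝 p.2) (𝓝 (Ψ p)) := by
    rw [hΨp]; exact (continuous_const.prodMk continuous_id).continuousAt
  have hright_inv : ∀ᶠ y in 𝓝 p.2, Ψ (inv (f p, y)) = (f p, y) := hemb_at.eventually hs.eventually_right_inverse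
  have hzero : ∀ᶠ y in 𝓝 p.2, f (g y, y) = f p := by
    filter_upwards [hright_inv] with y hy
    have h2 : (inv (f p, y)).2 = y := by simpa [hΨ] using congrArg Prod.snd hy
    have h1 : f (inv (f p, y)) = f p := by simpa [hΨ] using congrArg Prod.fst hy
    have hpair : inv (f p, y) = (g y, y) := Prod.ext rfl h2
    rw [← hpair]; exact h1
  refine ⟨g, ?_, ?_, hzero, ?_, ?_⟩
  · simp only [hg]
    rw [← hΨp, hinv, hs.localInverse_apply_image]
  · have hinvC : ContDiffAt 𝕜 n inv (Ψ p) := hΨc.to_localInverse hΨd hn0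
    rw [hΨp] at hinvC
    exact contDiffAt_fst.comp p.2 (hinvC.comp p.2 (contDiffAt_const.prodMk contDiffAt_id))
  · filter_upwards [hs.eventually_left_inverse] with q hq hfq
    have hΨq : Ψ q = (f p, q.2) := by simp [hΨ, hfq]
    rw [hΨq] at hq
    simp only [hg]
    rw [hinv, hq]
  · have hinvD : HasFDerivAt inv (Φ.symm : Z × Y →L[𝕜] X × Y) (Ψ p) := hs.to_localInverse.hasFDerivAt
    rw [hΨp] at hinvD
    have hl : HasFDerivAt (fun y : Y ↦ (f p, y)) (ContinuousLinearMap.inr 𝕜 Z Y) p.2 :=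
      (hasFDerivAt_const _ _).prodMk (hasFDerivAt_id p.2) |>.congr_fderiv (by ext <;> simp)
    have hcomp : HasFDerivAt (fun y : Y ↦ inv (f p, y)) ((Φ.symm : Z × Y →L[𝕜] X × Y).comp (ContinuousLinearMap.inr 𝕜 Z Y)) p.2 :=
      hinvD.comp p.2 hl
    have hfst := (ContinuousLinearMap.fst 𝕜 X Y).hasFDerivAt.comp p.2 hcomp
    refine hfst.congr_fderiv ?_
    ext v
    have : (Φ.symm : Z × Y →L[𝕜] X × Y) ((0 : Z), v) = M ((0 : Z), v) := rfl
    simp only [ContinuousLinearMap.coe_comp, Function.comp_apply, ContinuousLinearMap.inr_apply, this, hM_apply,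
      map_zero, zero_sub, ContinuousLinearMap.coe_fst', _root_.neg_apply]
    simp

end Literature.Analysis.Calculus

end
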